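import Summits.HodgeConjecture.CorCM.CMEllipticCurveTimesSimpleCMThreefoldWeilClass
import Summits.HodgeConjecture.CorCM.CMAlgebraDegreeLeSixNondegenerate
import Summits.HodgeConjecture.CorCM.TwoSimpleCMSurfacesHodge
import Summits.HodgeConjecture.CorCM.ImaginaryQuadraticsTimesConjSquareCMHodge
import Literature.AlgebraicGeometry.Pohlmann1968.SimpleCMAbelianFourfoldPowers
import HarnessLib

/-!
# Simple, pairwise non-isogenous CM abelian varieties of total dimension `≤ 4`: the product is stably nondegenerate
# iff no curve field embeds in the field of a threefold factor and a fourfold factor is nondegenerate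

COR-CM (cell `pub-hodgecm2`, binder seat `b16` gen 38, count-neutral claim CM4-CLASSIF, file 1 of 2; theorems only,
no definition, no named fact).  NEW as stated (an assembly of tree theorems), hence under `Summits/`.

[MoonenZarhin1999LowDim, Thm. (0.1)]: for a complex abelian variety `X` of dimension `4`, `B•(Xⁿ) = D•(Xⁿ)` for all
`n` UNLESS (a) `X ∼ X₁ × X₂` with `X₁` an elliptic curve with CM by `k` and `X₂` a simple threefold with
`k ↪ End⁰(X₂)`, (b) `X` simple with `End⁰(X)` a CM field containing an imaginary quadratic `k` acting with
multiplicities `(2,2)`, (c)/(d) (not of CM type); "in the cases (a), (b) … `D²(X) ≠ B²(X)`".  This file is the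
CM-TYPE LEVEL of the CM case, the dimension-`4` sequel of `CorCM/CMAlgebraDegreeLeSixNondegenerate` (total dimension
`≤ 3`: always nondegenerate): for SIMPLE, PAIRWISE NON-ISOGENOUS complex abelian varieties `A_i` with complex
multiplication, given as realisations `(A_i, ι_i, θ_i)` of CM types `(K_i; Φ_i)` on `H¹`, of total dimension
`Σ_i dim A_i ≤ 4` (degree multisets `{8}`, `{6,2}`, `{4,4}`, `{4,2,2}`, `{2,2,2,2}` and their sub-multisets):

* **`isNondegenerateFamily_iff_of_isSimple_of_sum_dim_le_four`** — the family `(Φ_i)_i` is NONDEGENERATE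
  (`rank Hg(∏_i A_i) = Σ_i dim A_i`) iff (¬a) no imaginary quadratic `K_a` (`dim A_a = 1`) embeds in a sextic `K_b`
  (`dim A_b = 3`) and (¬b) the type of a fourfold member (`dim A_b = 4`) is nondegenerate.  Engines, BY NAME: all
  curves — seat b16 gen 35 (`isNondegenerateFamily_of_finrank_eq_two`); one big slot — seat b16 gen 37
  (`isNondegenerateFamily_iff_forall_isEmpty_single`, Moonen–Zarhin (0.2) (4)), Ribet's bound in degree `≤ 6`, the
  square root of conjugation of a quartic CM field with a primitive type (seat p2, `exists_ringAut_smul_smul_eq_conjugate_of_isPrimitive`: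
  no imaginary quadratic field embeds); two surfaces — seat b23's junction `isNondegenerateFamily_simpleSurfaces`
  (cluster SIMPLE-CM-SURFACES: seats b24, p2, b23);
* **`hodgeClassSpan_prod_eq_divisorClassesSpan_of_sum_dim_le_four`**, **`hodgeConjectureFor_prod_of_sum_dim_le_four`**
  — under (¬a) ∧ (¬b): `Bᵐ ⊗ ℂ = Dᵐ ⊗ ℂ` and the Hodge conjecture on EVERY product `⨁_{j<N} A_{π j}` (every
  `∏_i A_i^{k_i}`), UNCONDITIONALLY (Moonen–Zarhin (0.1) (4), CM case, with Hazama–Murty);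
* **`forall_prod_hodgeClassSpan_eq_iff_of_sum_dim_le_four`**, **`exists_exceptional_prod_iff_of_sum_dim_le_four`**,
  **`hodgeConjectureFor_prod_or_exists_exceptional_of_isSimple_of_pairwise_not_isIsogenous`** — THE DICHOTOMY: `B• = D•` on all products
  iff (¬a) ∧ (¬b); a rational `(m,m)`-class outside `Dᵐ ⊗ ℂ` on some product iff (a) ∨ (b);
* **`exists_exceptional_two_prod_of_dim_one_dim_three_of_ringHom`**, **`exists_exceptional_two_of_dim_four_of_not_isNondegenerate`**
  — "the Weil classes are really needed": in case (a) every product containing the curve and the threefold, in case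
  (b) the fourfold itself, carries a rational `(2,2)`-class OUTSIDE `D² ⊗ ℂ` (seat b16 gen 37 Weil fibre; lit-deligne-3
  / lit-pohlmann octic criterion).

## References

* [MoonenZarhin1999LowDim] B. Moonen, Yu. Zarhin, *Hodge classes on abelian varieties of low dimension*, Math. Ann.
  315 (1999) 711–733, Thm. (0.1) (a), (b), (1), (4); §5 (5.1)–(5.2); Cor. (3.9).
* [Gordon1999HodgeAVSurvey] B. B. Gordon, *A survey of the Hodge conjecture for abelian varieties*, §3 Theorem, 7.4–7.7,
  9.2, 10.10.
* [Ribet1980] K. Ribet, §3 (3.7); [Shimura1998] G. Shimura, §8.2 Prop. 26, §8.4 Example (2).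
-/

noncomputable section

open CategoryTheory CategoryTheory.Limits NumberField NumberField.ComplexEmbedding IntermediateField Module
open scoped BigOperators

namespace Summit.HodgeConjecture.CorCM

open Literature.NumberTheory.ComplexMultiplication
open Literature.AlgebraicGeometry.Motives (AbelianVariety CMType)
open Literature.AlgebraicGeometry.Motives.AbelianVariety
open Literature.AlgebraicGeometry.HodgeTheory
open Literature.AlgebraicGeometry.ComplexMultiplication (IsCMTypeRealisation isSimple_iff_isPrimitive)
open Literature.AlgebraicGeometry.VanGeemen1994 (hodgeClassSpan)
open Literature.AlgebraicGeometry.Pohlmann1968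
open Literature.Barriers.HodgeConjecture (divisorClassesSpan)

/-! ## §1 Fields: an imaginary quadratic field does not embed in a quartic CM field carrying a primitive type -/

section Fields

variable {I : Type} {K : I → Type} [∀ i, Field (K i)] [∀ i, NumberField (K i)] [∀ i, IsCMField (K i)]

/-- **No imaginary quadratic `K_a` embeds in a quartic CM field `K_b` carrying a PRIMITIVE CM type** (`K_b` is then
cyclic or non-Galois, not biquadratic: some `τ ∈ Aut(ℂ)` squares to complex conjugation on `Hom(K_b, ℂ)` —
seat p2 — which is incompatible with an embedded quadratic field, seat b16 gen 37 `isEmpty_ringHom_of_smul_smul`).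
Hence `E × S` is never in Moonen–Zarhin's case (a). [cite: Shimura1998, §8.4 Example (2)]
[cite: MoonenZarhin1999LowDim, §5 (5.2)] -/
theorem isEmpty_ringHom_of_finrank_eq_two_of_isPrimitive_quartic (Φ : ∀ i, CMType (K i)) {a b : I}
    (h2 : finrank ℚ (K a) = 2) (h4 : finrank ℚ (K b) = 4) {φ₀ : K b →+* ℂ}
    (hprim : IsPrimitive (ℂ ≃+* ℂ) (Φ b).1 φ₀) : IsEmpty (K a →+* K b) :=
  isEmpty_ringHom_of_smul_smul Φ h2 (QuarticCM.exists_ringAut_smul_smul_eq_conjugate_of_isPrimitive h4 hprim)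

end Fields

/-! ## §2 The criterion for simple, pairwise non-isogenous CM abelian varieties of total dimension `≤ 4` -/

section Criterion

variable {I : Type} {K : I → Type} [∀ i, Field (K i)] [∀ i, NumberField (K i)] [∀ i, IsCMField (K i)] [Fintype I]
  [DecidableEq I] [Nonempty I] {Φ : ∀ i, CMType (K i)}
variable {A : I → AbelianVariety ℂ} {ι : ∀ i, 𝓞 (K i) →+* End (A i)}
  {θ : ∀ i, K i →+* Module.End ℂ (complexBetti (A i).X 1)}

omit [DecidableEq I] [Nonempty I] in
/-- Bookkeeping: two distinct slots have total dimension at most `Σ_i dim A_i`. [folklore] -/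
private theorem dim_add_dim_le_sum (A : I → AbelianVariety ℂ) {i j : I} (h : i ≠ j) :
    (A i).dim + (A j).dim ≤ ∑ k, (A k).dim := by
  classical
  have h1 := Finset.add_sum_erase Finset.univ (fun k => (A k).dim) (Finset.mem_univ i)
  have h2 : (A j).dim ≤ ∑ k ∈ Finset.univ.erase i, (A k).dim :=
    Finset.single_le_sum (fun k _ => Nat.zero_le ((A k).dim)) (Finset.mem_erase.2 ⟨h.symm, Finset.mem_univ j⟩)
  omega

omit [DecidableEq I] [Nonempty I] in
/-- Bookkeeping: three pairwise distinct slots have total dimension at most `Σ_i dim A_i`. [folklore] -/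
private theorem dim_add_dim_add_dim_le_sum (A : I → AbelianVariety ℂ) {i j l : I} (hij : i ≠ j) (hil : i ≠ l)
    (hjl : j ≠ l) : (A i).dim + (A j).dim + (A l).dim ≤ ∑ k, (A k).dim := by
  classical
  have h1 := Finset.add_sum_erase Finset.univ (fun k => (A k).dim) (Finset.mem_univ i)
  have h2 := Finset.add_sum_erase (Finset.univ.erase i) (fun k => (A k).dim)
    (Finset.mem_erase.2 ⟨hij.symm, Finset.mem_univ j⟩)
  have h3 : (A l).dim ≤ ∑ k ∈ (Finset.univ.erase i).erase j, (A k).dim :=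
    Finset.single_le_sum (fun k _ => Nat.zero_le ((A k).dim))
      (Finset.mem_erase.2 ⟨hjl.symm, Finset.mem_erase.2 ⟨hil.symm, Finset.mem_univ l⟩⟩)
  omega

/-- **MAIN CRITERION (Moonen–Zarhin (0.1), CM case, on CM types).**  Let `A_i` (`i ∈ I`) be SIMPLE, PAIRWISE
NON-ISOGENOUS complex abelian varieties with complex multiplication — realisations of CM types `(K_i; Φ_i)` on `H¹` —
of total dimension `Σ_i dim A_i ≤ 4`.  Then the family `(Φ_i)_i` is nondegenerate (`rank Hg(∏_i A_i) = Σ_i dim A_i`,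
no power of `∏_i A_i` supports an exotic Hodge class) iff
(¬a) for all slots `a ≠ b` with `dim A_a = 1`, `dim A_b = 3` the imaginary quadratic field `K_a` does NOT embed in the
sextic field `K_b`, and (¬b) for every slot with `dim A_b = 4` the (primitive, octic) type `Φ_b` is nondegenerate.
Proof by the dimension multiset: all curves (pairwise non-isomorphic quadratic fields, gen 35); one slot of dimension
`≥ 2` and curves (gen 37's single-big-slot criterion; a quartic slot is nondegenerate by Ribet and admits no embedded
quadratic field, a sextic slot is nondegenerate by Ribet, an octic slot is alone); two surfaces (seat b23's junction).
[cite: MoonenZarhin1999LowDim, Thm. (0.1) (1), (4) and §5 (5.2)] [cite: Gordon1999HodgeAVSurvey, 7.4–7.5]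
[cite: Ribet1980, §3 (3.7)] -/
theorem isNondegenerateFamily_iff_of_isSimple_of_sum_dim_le_four
    (hA : ∀ i, IsCMTypeRealisation (Φ i) (A i) (ι i) (θ i)) (hs : ∀ i, (A i).IsSimple)
    (hniso : ∀ i j, i ≠ j → ¬ AbelianVariety.IsIsogenous (A i) (A j)) (h4 : ∑ i, (A i).dim ≤ 4) :
    CMAlgebra.IsNondegenerateFamily Φ ↔
      (∀ a b, a ≠ b → (A a).dim = 1 → (A b).dim = 3 → IsEmpty (K a →+* K b)) ∧
        ∀ b, (A b).dim = 4 → IsNondegenerate (Φ b) := by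
  classical
  have hsep := CMAlgebra.isSeparatingFamily_of_isSimple_of_pairwise_not_isIsogenous hA hs hniso
  have hdeg : ∀ i, finrank ℚ (K i) = 2 * (A i).dim := finrank_eq_two_mul_dim hA
  have hpos : ∀ i, 0 < (A i).dim := fun i => by
    have h := Module.finrank_pos (R := ℚ) (M := K i)
    rw [hdeg i] at h
    omega
  have hle : ∀ i, (A i).dim ≤ ∑ j, (A j).dim := fun i =>
    Finset.single_le_sum (fun j _ => Nat.zero_le ((A j).dim)) (Finset.mem_univ i)
  by_cases hall : ∀ i, (A i).dim = 1
  · -- all slots are CM elliptic curves with pairwise non-isomorphic fields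
    have h2 : ∀ i, finrank ℚ (K i) = 2 := fun i => by rw [hdeg, hall]
    exact ⟨fun _ => ⟨fun a b _ _ hb => by have := hall b; omega, fun b hb => by have := hall b; omega⟩,
      fun _ => isNondegenerateFamily_of_finrank_eq_two h2 hsep⟩
  push Not at hall
  obtain ⟨i₁, hi₁⟩ := hall
  have hi₁2 : 2 ≤ (A i₁).dim := by have := hpos i₁; omega
  by_cases huniq : ∀ j, j ≠ i₁ → (A j).dim = 1
  · -- `i₁` is the only slot of dimension `≥ 2`
    have h2 : ∀ j, j ≠ i₁ → finrank ℚ (K j) = 2 := fun j hj => by rw [hdeg, huniq j hj]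
    have hχ := exists_not_iff_of_isSeparatingFamily (fun i => i = i₁) Φ h2
      (isSeparatingFamily_subtype hsep fun j => j ≠ i₁)
    rw [isNondegenerateFamily_iff_forall_isEmpty_single i₁ Φ h2 hχ]
    obtain ⟨φ₁⟩ : Nonempty (K i₁ →+* ℂ) := inferInstance
    have hprim : IsPrimitive (ℂ ≃+* ℂ) (Φ i₁).1 φ₁ := hsep.isPrimitive i₁ φ₁
    rcases (show (A i₁).dim = 2 ∨ (A i₁).dim = 3 ∨ (A i₁).dim = 4 by have := hle i₁; omega) with hd | hd | hd
    · -- a quartic slot and curves: both sides hold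
      have h4K : finrank ℚ (K i₁) = 4 := by rw [hdeg, hd]
      have hnd : IsNondegenerate (Φ i₁) := isNondegenerate_of_isPrimitive_of_finrank_le_six (Φ i₁) (by omega) φ₁ hprim
      have hemp : ∀ a, a ≠ i₁ → IsEmpty (K a →+* K i₁) := fun a ha =>
        isEmpty_ringHom_of_finrank_eq_two_of_isPrimitive_quartic Φ (h2 a ha) h4K hprim
      refine ⟨fun _ => ⟨fun a b _ _ hb => ?_, fun b hb => ?_⟩, fun _ => ⟨hnd, hemp⟩⟩
      · exfalso
        by_cases hb1 : b = i₁
        · rw [hb1] at hb; omega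
        · have := huniq b hb1; omega
      · exfalso
        by_cases hb1 : b = i₁
        · rw [hb1] at hb; omega
        · have := huniq b hb1; omega
    · -- a sextic slot and curves: nondegenerate iff no curve field embeds
      have h6K : finrank ℚ (K i₁) = 6 := by rw [hdeg, hd]
      have hnd : IsNondegenerate (Φ i₁) := isNondegenerate_of_isPrimitive_of_finrank_le_six (Φ i₁) (by omega) φ₁ hprim
      refine ⟨fun h => ⟨fun a b hab _ hb => ?_, fun b hb => ?_⟩, fun h => ⟨hnd, fun a ha => h.1 a i₁ ha (huniq a ha) hd⟩⟩
      · have hb1 : b = i₁ := by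
          by_contra hb1
          have := huniq b hb1
          omega
        subst hb1
        exact h.2 a hab
      · exfalso
        by_cases hb1 : b = i₁
        · rw [hb1] at hb; omega
        · have := huniq b hb1; omega
    · -- an octic slot: it is alone
      have hsub : ∀ j, j = i₁ := fun j => by
        by_contra hj
        have h₁ := dim_add_dim_le_sum A hj
        have h₂ := huniq j hj
        omega
      refine ⟨fun h => ⟨fun a b hab _ _ => (hab ((hsub a).trans (hsub b).symm)).elim, fun b _ => ?_⟩,
        fun h => ⟨h.2 i₁ hd, fun a ha => (ha (hsub a)).elim⟩⟩
      obtain rfl := hsub b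
      exact h.1
  · -- a second slot `i₀ ≠ i₁` of dimension `≥ 2`: two simple CM surfaces and nothing else
    push Not at huniq
    obtain ⟨i₀, hi₀, hi₀1⟩ := huniq
    have hi₀2 : 2 ≤ (A i₀).dim := by have := hpos i₀; omega
    have h01 := dim_add_dim_le_sum A hi₀
    have hI : ∀ j, j = i₀ ∨ j = i₁ := fun j => by
      by_contra hj
      push Not at hj
      have h₃ := dim_add_dim_add_dim_le_sum A hj.1 hj.2 hi₀
      have := hpos j
      omega
    have h4K : ∀ i, finrank ℚ (K i) = 4 := fun i => by
      rcases hI i with rfl | rfl <;> rw [hdeg] <;> omega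
    refine ⟨fun _ => ⟨fun a b _ _ hb => ?_, fun b hb => ?_⟩,
      fun _ => isNondegenerateFamily_simpleSurfaces hi₀ hI h4K hA hs hniso⟩
    · exfalso; rcases hI b with rfl | rfl <;> omega
    · exfalso; rcases hI b with rfl | rfl <;> omega

end Criterion

/-! ## §3 Hodge classes on the products: `B• = D•` and the Hodge conjecture, or exceptional classes -/

section Geometry

variable {I : Type} {K : I → Type} [∀ i, Field (K i)] [∀ i, NumberField (K i)] [∀ i, IsCMField (K i)] [Fintype I]
  [DecidableEq I] [Nonempty I] {Φ : ∀ i, CMType (K i)}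
variable {A : I → AbelianVariety ℂ} {ι : ∀ i, 𝓞 (K i) →+* End (A i)}
  {θ : ∀ i, K i →+* Module.End ℂ (complexBetti (A i).X 1)}

/-- **`Bᵐ ⊗ ℂ = Dᵐ ⊗ ℂ` on every `∏_i A_i^{k_i}`** (every `⨁_{j<N} A_{π j}`) for simple, pairwise non-isogenous CM
abelian varieties of total dimension `≤ 4` satisfying (¬a) ∧ (¬b) (Moonen–Zarhin (0.1) (4), CM case: no power and no
product of powers supports an exotic Hodge class). [cite: MoonenZarhin1999LowDim, Thm. (0.1) (4)]
[cite: Gordon1999HodgeAVSurvey, 7.5] -/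
theorem hodgeClassSpan_prod_eq_divisorClassesSpan_of_sum_dim_le_four
    (hA : ∀ i, IsCMTypeRealisation (Φ i) (A i) (ι i) (θ i)) (hs : ∀ i, (A i).IsSimple)
    (hniso : ∀ i j, i ≠ j → ¬ AbelianVariety.IsIsogenous (A i) (A j)) (h4 : ∑ i, (A i).dim ≤ 4)
    (hfor : ∀ a b, a ≠ b → (A a).dim = 1 → (A b).dim = 3 → IsEmpty (K a →+* K b))
    (hoct : ∀ b, (A b).dim = 4 → IsNondegenerate (Φ b)) {N : ℕ} (π : Fin N → I) (m : ℕ) :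
    hodgeClassSpan (⨁ fun j : Fin N => A (π j)).dim (⨁ fun j : Fin N => A (π j)).X m =
      divisorClassesSpan (⨁ fun j : Fin N => A (π j)).X (⨁ fun j : Fin N => A (π j)).dim m :=
  ((isNondegenerateFamily_iff_of_isSimple_of_sum_dim_le_four hA hs hniso h4).2 ⟨hfor, hoct⟩)
    |>.hodgeClassSpan_prod_eq_divisorClassesSpan hA π m

/-- **The Hodge conjecture for every `∏_i A_i^{k_i}`** (every `⨁_{j<N} A_{π j}`) of SIMPLE, PAIRWISE NON-ISOGENOUS
complex abelian varieties with complex multiplication of total dimension `Σ_i dim A_i ≤ 4` satisfying (¬a) no curve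
field embeds in the field of a threefold and (¬b) a fourfold member has a nondegenerate type — UNCONDITIONALLY
(Moonen–Zarhin (0.1) (4) + Hazama–Murty, CM case: e.g. `E × T` with `k ↪̸ K_T`, `S × S′`, `E × E′ × S`, `E₁ × ⋯ × E₄`,
a nondegenerate simple CM fourfold, and all products of their powers). [cite: MoonenZarhin1999LowDim, Thm. (0.1) (4)]
[cite: Gordon1999HodgeAVSurvey, 7.5 and 10.10] -/
theorem hodgeConjectureFor_prod_of_sum_dim_le_four
    (hA : ∀ i, IsCMTypeRealisation (Φ i) (A i) (ι i) (θ i)) (hs : ∀ i, (A i).IsSimple)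
    (hniso : ∀ i j, i ≠ j → ¬ AbelianVariety.IsIsogenous (A i) (A j)) (h4 : ∑ i, (A i).dim ≤ 4)
    (hfor : ∀ a b, a ≠ b → (A a).dim = 1 → (A b).dim = 3 → IsEmpty (K a →+* K b))
    (hoct : ∀ b, (A b).dim = 4 → IsNondegenerate (Φ b)) {N : ℕ} (π : Fin N → I) :
    HodgeConjectureFor (⨁ fun j : Fin N => A (π j)).dim (⨁ fun j : Fin N => A (π j)).X :=
  ((isNondegenerateFamily_iff_of_isSimple_of_sum_dim_le_four hA hs hniso h4).2 ⟨hfor, hoct⟩)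
    |>.hodgeConjectureFor_prod hA π

/-- **`B• = D•` on EVERY product iff (¬a) ∧ (¬b)** (Moonen–Zarhin (0.1) (1)/(4) read through Hazama–Murty: simple,
pairwise non-isogenous factors make the family separating). [cite: MoonenZarhin1999LowDim, Thm. (0.1) (1) and (4)]
[cite: Gordon1999HodgeAVSurvey, 7.5–7.6] -/
theorem forall_prod_hodgeClassSpan_eq_iff_of_sum_dim_le_four
    (hA : ∀ i, IsCMTypeRealisation (Φ i) (A i) (ι i) (θ i)) (hs : ∀ i, (A i).IsSimple)
    (hniso : ∀ i j, i ≠ j → ¬ AbelianVariety.IsIsogenous (A i) (A j)) (h4 : ∑ i, (A i).dim ≤ 4) :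
    (∀ (N : ℕ) (π : Fin N → I) (m : ℕ),
        hodgeClassSpan (⨁ fun j : Fin N => A (π j)).dim (⨁ fun j : Fin N => A (π j)).X m =
          divisorClassesSpan (⨁ fun j : Fin N => A (π j)).X (⨁ fun j : Fin N => A (π j)).dim m) ↔
      (∀ a b, a ≠ b → (A a).dim = 1 → (A b).dim = 3 → IsEmpty (K a →+* K b)) ∧
        ∀ b, (A b).dim = 4 → IsNondegenerate (Φ b) := by
  rw [← CMAlgebra.isNondegenerateFamily_iff_forall_prod_hodgeClassSpan_eq
    (CMAlgebra.isSeparatingFamily_of_isSimple_of_pairwise_not_isIsogenous hA hs hniso) hA]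
  exact isNondegenerateFamily_iff_of_isSimple_of_sum_dim_le_four hA hs hniso h4

/-- **An exotic Hodge class on SOME product `∏_i A_i^{k_i}` iff (a) ∨ (b)**: a rational `(m,m)`-class outside
`Dᵐ ⊗ ℂ` on some `⨁_{j<N} A_{π j}` exists iff some curve field embeds in the field of a threefold factor or a fourfold
factor has a degenerate type (Hazama–Murty for the degenerate family). [cite: MoonenZarhin1999LowDim, Thm. (0.1) (1) and (4)]
[cite: Gordon1999HodgeAVSurvey, 7.5 and 9.2] -/
theorem exists_exceptional_prod_iff_of_sum_dim_le_four
    (hA : ∀ i, IsCMTypeRealisation (Φ i) (A i) (ι i) (θ i)) (hs : ∀ i, (A i).IsSimple)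
    (hniso : ∀ i j, i ≠ j → ¬ AbelianVariety.IsIsogenous (A i) (A j)) (h4 : ∑ i, (A i).dim ≤ 4) :
    (∃ (N : ℕ) (π : Fin N → I) (m : ℕ) (c : complexBetti (⨁ fun j : Fin N => A (π j)).X (2 * m)),
        IsRationalClass c ∧
          IsOfHodgeType (⨁ fun j : Fin N => A (π j)).dim (⨁ fun j : Fin N => A (π j)).X (2 * m) m m c ∧
          c ∉ divisorClassesSpan (⨁ fun j : Fin N => A (π j)).X (⨁ fun j : Fin N => A (π j)).dim m) ↔
      ¬((∀ a b, a ≠ b → (A a).dim = 1 → (A b).dim = 3 → IsEmpty (K a →+* K b)) ∧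
          ∀ b, (A b).dim = 4 → IsNondegenerate (Φ b)) := by
  rw [← isNondegenerateFamily_iff_of_isSimple_of_sum_dim_le_four hA hs hniso h4]
  refine ⟨fun ⟨N, π, m, c, hcQ, hcH, hcD⟩ hnd => (hnd.not_exists_exceptional_prod hA π m) ⟨c, hcQ, hcH, hcD⟩,
    fun hnd => ?_⟩
  exact CMAlgebra.exists_exceptional_prod_of_not_isNondegenerateFamily
    (CMAlgebra.isSeparatingFamily_of_isSimple_of_pairwise_not_isIsogenous hA hs hniso) hnd hA

omit [DecidableEq I] in
/-- **THE HAZAMA–MURTY DICHOTOMY for simple, pairwise non-isogenous CM abelian varieties** (any number, any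
dimensions): EITHER the Hodge conjecture holds on every `∏_i A_i^{k_i}` with `B• = D•` there (unconditionally), OR
some such product carries a rational `(m,m)`-class outside `Dᵐ ⊗ ℂ` (simple and pairwise non-isogenous factors make
the family of types separating, so Hazama–Murty applies).  In total dimension `≤ 4` the second case is exactly
Moonen–Zarhin's (a) ∨ (b) (`exists_exceptional_prod_iff_of_sum_dim_le_four`). [cite: MoonenZarhin1999LowDim, Thm. (0.1)]
[cite: Gordon1999HodgeAVSurvey, 7.5, 9.2 and 10.10] -/
theorem hodgeConjectureFor_prod_or_exists_exceptional_of_isSimple_of_pairwise_not_isIsogenous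
    (hA : ∀ i, IsCMTypeRealisation (Φ i) (A i) (ι i) (θ i)) (hs : ∀ i, (A i).IsSimple)
    (hniso : ∀ i j, i ≠ j → ¬ AbelianVariety.IsIsogenous (A i) (A j)) :
    (∀ (N : ℕ) (π : Fin N → I),
        HodgeConjectureFor (⨁ fun j : Fin N => A (π j)).dim (⨁ fun j : Fin N => A (π j)).X ∧
          ∀ m : ℕ, hodgeClassSpan (⨁ fun j : Fin N => A (π j)).dim (⨁ fun j : Fin N => A (π j)).X m =
            divisorClassesSpan (⨁ fun j : Fin N => A (π j)).X (⨁ fun j : Fin N => A (π j)).dim m) ∨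
      ∃ (N : ℕ) (π : Fin N → I) (m : ℕ) (c : complexBetti (⨁ fun j : Fin N => A (π j)).X (2 * m)),
        IsRationalClass c ∧
          IsOfHodgeType (⨁ fun j : Fin N => A (π j)).dim (⨁ fun j : Fin N => A (π j)).X (2 * m) m m c ∧
          c ∉ divisorClassesSpan (⨁ fun j : Fin N => A (π j)).X (⨁ fun j : Fin N => A (π j)).dim m := by
  by_cases hnd : CMAlgebra.IsNondegenerateFamily Φ
  · exact Or.inl fun N π => ⟨hnd.hodgeConjectureFor_prod hA π, fun m => hnd.hodgeClassSpan_prod_eq_divisorClassesSpan hA π m⟩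
  · exact Or.inr (CMAlgebra.exists_exceptional_prod_of_not_isNondegenerateFamily
      (CMAlgebra.isSeparatingFamily_of_isSimple_of_pairwise_not_isIsogenous hA hs hniso) hnd hA)

omit [DecidableEq I] [Nonempty I] in
/-- **Case (a), sharp placement: a curve field embedded in the field of a threefold puts a rational `(2,2)`-class
OUTSIDE `D² ⊗ ℂ` on every product containing both** (a Weil class of `k = K_a`; seat b16 gen 37's Weil fibre), for
simple, pairwise non-isogenous factors — "the Weil classes are really needed … `D²(X) ≠ B²(X)`".
[cite: MoonenZarhin1999LowDim, Thm. (0.1) (a), (1) and (1.9)] [cite: Gordon1999HodgeAVSurvey, 9.2] -/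
theorem exists_exceptional_two_prod_of_dim_one_dim_three_of_ringHom
    (hA : ∀ i, IsCMTypeRealisation (Φ i) (A i) (ι i) (θ i)) (hs : ∀ i, (A i).IsSimple)
    (hniso : ∀ i j, i ≠ j → ¬ AbelianVariety.IsIsogenous (A i) (A j)) {N : ℕ} (π : Fin N → I) {j₀ j₁ : Fin N}
    (h1 : (A (π j₀)).dim = 1) (h3 : (A (π j₁)).dim = 3) (e : K (π j₀) →+* K (π j₁)) :
    ∃ c : complexBetti (⨁ fun j : Fin N => A (π j)).X (2 * 2), IsRationalClass c ∧
      IsOfHodgeType (⨁ fun j : Fin N => A (π j)).dim (⨁ fun j : Fin N => A (π j)).X (2 * 2) 2 2 c ∧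
      c ∉ divisorClassesSpan (⨁ fun j : Fin N => A (π j)).X (⨁ fun j : Fin N => A (π j)).dim 2 := by
  have hsep := CMAlgebra.isSeparatingFamily_of_isSimple_of_pairwise_not_isIsogenous hA hs hniso
  have h2 : finrank ℚ (K (π j₀)) = 2 := by rw [finrank_eq_two_mul_dim hA, h1]
  have h6 : finrank ℚ (K (π j₁)) = 6 := by rw [finrank_eq_two_mul_dim hA, h3]
  obtain ⟨φ₁⟩ : Nonempty (K (π j₁) →+* ℂ) := inferInstance
  exact exists_exceptional_two_prod_of_ringHom hsep hA π h2 h6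
    (isNondegenerate_of_isPrimitive_of_finrank_le_six (Φ (π j₁)) (by omega) φ₁ (hsep.isPrimitive (π j₁) φ₁)) e

omit [Fintype I] [DecidableEq I] [Nonempty I] in
/-- **Case (b), sharp placement: a simple CM abelian FOURFOLD with a degenerate type carries a rational `(2,2)`-class
OUTSIDE `D² ⊗ ℂ` on itself** (its exceptional classes live in `H⁴` or nowhere: lit-deligne-3 / lit-pohlmann, Moonen–Zarhin
1995 for CM fourfolds). [cite: MoonenZarhin1999LowDim, Thm. (0.1) (b) and (1)] [cite: Gordon1999HodgeAVSurvey, 5.13] -/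
theorem exists_exceptional_two_of_dim_four_of_not_isNondegenerate {i : I}
    (hA : IsCMTypeRealisation (Φ i) (A i) (ι i) (θ i)) (hs : (A i).IsSimple) (h4 : (A i).dim = 4)
    (hdeg : ¬ IsNondegenerate (Φ i)) :
    ∃ c : complexBetti (A i).X (2 * 2), IsRationalClass c ∧ IsOfHodgeType (A i).dim (A i).X (2 * 2) 2 2 c ∧
      c ∉ divisorClassesSpan (A i).X (A i).dim 2 := by
  obtain ⟨φ₀⟩ : Nonempty (K i →+* ℂ) := inferInstance
  have h8 : finrank ℚ (K i) = 8 := by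
    rw [Literature.AlgebraicGeometry.Pohlmann1968.finrank_eq_two_mul_dim_of_isCMTypeRealisation hA, h4]
  have hcm := isOfCMType_of_isCMTypeRealisation hA
  have hnot : ¬ IsDivisorGenerated (A i) := fun hD =>
    hdeg ((isDivisorGenerated_iff_isNondegenerate_of_finrank_eq_eight h8 φ₀ ((isSimple_iff_isPrimitive hA φ₀).1 hs) hA).1 hD)
  rcases hodgeConjectureFor_powSucc_or_exists_exceptional_two_of_dim_four hs h4 hcm with hall | hex
  · exact (hnot ((hall 0).1)).elim
  · exact hex

end Geometry

end Summit.HodgeConjecture.CorCM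

end
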